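import Mathlib
import HarnessLib
import Literature.Geometry.DiscreteGeometry.BondGraph
import Literature.Geometry.DiscreteGeometry.KissingPatterns
import Literature.MathematicalPhysics.StatisticalMechanics.BarlowStacking
import Literature.MathematicalPhysics.StatisticalMechanics.HaggStacking
import Summits.AtomisticToContinuum.Crystallization.Theorems.PricedLinkCensusSoftLayerPropagationOneStackingMapSearchSound
import Summits.AtomisticToContinuum.Crystallization.Theorems.PricedLinkCensusSoftLayerPropagationOneStackingMapRunAll
import Summits.AtomisticToContinuum.Crystallization.Theorems.PricedLinkCensusSoftLayerPropagationOneStackingMapDev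
import Summits.AtomisticToContinuum.Crystallization.Theorems.PricedLinkCensusSoftLayerPropagationOneStackingMapBarlow

/-!
# Stub `stub_oneStackingMap` of line `Sketch` v7 (crux `SoftLayerPropagation`): the graph-ball
# engine — one Barlow stacking on the shadow `33/10`-ball of an exact development

Route `PricedLinkCensus`, crux `SoftLayerPropagation` (stmt-AtomisticToContinuum-14233), line
`Sketch`, registered stub `stub_oneStackingMap`.  Given the exact development `D` on the graph
`5`-ball about `i` (at every such site the bond-neighbours are carried exactly onto a rotated
FCC / HCP pattern and bonds among them are the unit shadow distances), there are a Hägg sequence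
`s` and a rigid motion `φ` with: every graph-`5`-ball site with shadow within `33/10` of `D i` has
`φ (D j)` in `barlowStacking 1 √(2/3) s`; every stacking point within `33/10` of `φ (D i)` is so
realised; the realisation is injective.

PROOF (computational, `native_decide`).  This is Hales, *Dense Sphere Packings* §1.3 ("a packing
in which every tangent arrangement is FCC or HCP is a Barlow stacking") cut down to a finite ball
of an abstract exact development, and it is SHARP: the acute double-twin (three FCC grains, two
coherent twin planes of the middle grain meeting on a junction row six bonds from the centre) has
an exact graph `5`-ball and sees both foreign grains at shadow distance exactly `√11 = 3.3166`,
so the radius `33/10 ∈ (√10, √11)` cannot be enlarged.  The proof is a VERIFIED DEVELOPMENT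
SEARCH: the hypotheses define an abstract development (`…OneStackingMapDev.lean`: shadow
positions in the frame of the centre at scale `nn² = 2`, exact stars on the `4`-ball, twelve
bonds on the `5`-ball from charge-freeness); the search (`…OneStackingMapSearchDefs/Leaf.lean`)
enumerates, with fuel, every way the graph `4`-ball can develop (pattern completions through the
recorded partial star by Cramer numerators over `ℤ` — `completions_sound`; slot linking with
forced / optional identifications — `linkSlots_sound`; closing the star — `finish_sound`), and at
every leaf checks one Barlow stacking on the shadow `33/10`-ball (frame, letters, membership,
exact count — `leaf_sound`); every development is realised by some branch (`search_sound`,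
`frontier_sound`, `checkParts_sound`), and the `53` round-robin parts below the depth-`3`
frontier (`211` states; `4227` leaves, about `4.3·10⁵` expansion steps) all return `true`
(`checkPart_all`, `native_decide`, `…OneStackingMapRunNN.lean`).  The shadow-frame conclusion is
turned into the Barlow stacking by `concl_of_dev` (`…OneStackingMapBarlow.lean`: Hägg sequence
from the letters, the frames are Barlow frames).  The bookkeeping is [folklore]; the search is
this line's.
-/

noncomputable section

namespace Summit.AtomisticToContinuum.Crystallization.Theorems

/-- **Registered stub `stub_oneStackingMap` (line `Sketch` v7 of crux `SoftLayerPropagation`)**: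
the graph-ball engine — an exact development of the graph `5`-ball is ONE Barlow stacking on the
shadow ball of radius `33/10` about the centre (membership, surjectivity, injectivity), after a
rigid motion.  Proved by the verified development search (computational, `native_decide`); sharp
at `√11`; the finite-ball form of Hales's layer theorem (Dense Sphere Packings, §1.3). [folklore] -/
theorem stub_oneStackingMap :
    ∀ η : ℝ, 0 < η → η ≤ 1 / 100 →
      ∀ (N : ℕ) (y : Fin N → EuclideanSpace ℝ (Fin 3)) (i : Fin N),
        0 < Literature.Geometry.DiscreteGeometry.nearestDist y i →
        (∀ j : Fin N, dist (y i) (y j) ≤ 8 * Literature.Geometry.DiscreteGeometry.nearestDist y i →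
          Literature.Geometry.DiscreteGeometry.IsChargeFree η y j) →
        ∀ D : Fin N → EuclideanSpace ℝ (Fin 3),
          (∀ j : Fin N, (∃ w : (Literature.Geometry.DiscreteGeometry.bondGraph η y).Walk i j, w.length ≤ 5) →
            ∃ (P : Finset (EuclideanSpace ℝ (Fin 3)))
              (Q R : EuclideanSpace ℝ (Fin 3) →ₗᵢ[ℝ] EuclideanSpace ℝ (Fin 3)),
              (P = Literature.Geometry.DiscreteGeometry.fccKissingPattern ∨
                P = Literature.Geometry.DiscreteGeometry.hcpKissingPattern) ∧
              D '' {k | (Literature.Geometry.DiscreteGeometry.bondGraph η y).Adj j k} =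
                (fun p => D j + Q p) '' (P : Set (EuclideanSpace ℝ (Fin 3))) ∧
              (∀ k, (Literature.Geometry.DiscreteGeometry.bondGraph η y).Adj j k →
                ‖(y k - y j) - Literature.Geometry.DiscreteGeometry.nearestDist y j • R (D k - D j)‖ ≤
                  Literature.Geometry.DiscreteGeometry.nearestDist y j / 4) ∧
              (∀ k k', (Literature.Geometry.DiscreteGeometry.bondGraph η y).Adj j k →
                (Literature.Geometry.DiscreteGeometry.bondGraph η y).Adj j k' →
                ((Literature.Geometry.DiscreteGeometry.bondGraph η y).Adj k k' ↔
                  dist (D k) (D k') = 1))) →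
          ∃ (s : ℤ → ℤ) (φ : EuclideanSpace ℝ (Fin 3) ≃ᵃⁱ[ℝ] EuclideanSpace ℝ (Fin 3)),
            Literature.MathematicalPhysics.StatisticalMechanics.IsHaggSeq s ∧
            (∀ j : Fin N, (∃ w : (Literature.Geometry.DiscreteGeometry.bondGraph η y).Walk i j, w.length ≤ 5) →
              dist (D j) (D i) ≤ 33 / 10 →
              φ (D j) ∈ Literature.MathematicalPhysics.StatisticalMechanics.barlowStacking 1
                (Real.sqrt (2 / 3)) s) ∧
            (∀ z ∈ Literature.MathematicalPhysics.StatisticalMechanics.barlowStacking 1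
                (Real.sqrt (2 / 3)) s,
              dist z (φ (D i)) ≤ 33 / 10 →
              ∃ j : Fin N, (∃ w : (Literature.Geometry.DiscreteGeometry.bondGraph η y).Walk i j,
                w.length ≤ 5) ∧ dist (D j) (D i) ≤ 33 / 10 ∧ φ (D j) = z) ∧
            (∀ j k : Fin N, (∃ w : (Literature.Geometry.DiscreteGeometry.bondGraph η y).Walk i j, w.length ≤ 5) →
              (∃ w : (Literature.Geometry.DiscreteGeometry.bondGraph η y).Walk i k, w.length ≤ 5) →
              dist (D j) (D i) ≤ 33 / 10 → dist (D k) (D i) ≤ 33 / 10 → D j = D k → j = k) := by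
  intro η hη0 hη1 N y i hnn hcf D hD
  set H : OneStacking.Hyp := ⟨η, hη0, hη1, N, y, i, hnn, hcf, D, hD⟩ with hH
  obtain ⟨C⟩ := OneStacking.checkParts_sound H.dev (d := 3) (parts := 53) (fuel := 1000) (by norm_num) (by norm_num)
    OneStacking.checkPart_all
  exact OneStacking.concl_of_dev H C

end Summit.AtomisticToContinuum.Crystallization.Theorems
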